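import Summits.MatrixMultiplication.MatrixMultiplication.Theorems.GradedDesignFamily.Negative.SubfieldCellNineRowThreeAlt
import Summits.MatrixMultiplication.MatrixMultiplication.Theorems.GradedDesignFamily.Negative.SubfieldCellNineRowThreeCapacity

/-!
# Subfield cell `GL₂(𝔽₉) ⊃ SL₂(𝔽₃)` at level one — VIII-b: `|Y| ≥ 3 ⇒ |Z| ≤ 16`

**Honest framing.** VALUE = a theorem about ONE finite cell of ONE skeleton line
(`quadratic_extension_level_one_cell`, stub S3 `stub_subfieldCell`, crux `GradedDesignFamily`,
route `LevelGradedCohnUmans`): a decidable verdict on small instances, **not** progress on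
`Summit.MatrixMultiplication`, and it does **not** refute the asymptotic stub.

**Results.** For every `(k, K, φ)` with `|k| = 3`, `|K| = |k|²`, `φ : SL₂(k) ↪ GL₂(K)` and every
level-one separated pair `(Y, Z)` (S3's clause verbatim): `|Y| ≥ 3 ⇒ |Z| ≤ 16`
(`subfieldCell_nine_rowThree`); in particular the `(3,17)` instance is FALSE
(`subfieldCell_nine_no_3x17`).  Together with files III/V (`|Y| ≥ 2 ⇒ |Z| ≤ 17`, sharp by witness D)
this leaves, IN LEAN, the range `9 ≤ |Z| ≤ 16` at `|Y| = 3` open (witness C `(4,8)` is TRUE;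
the gen-8 Python λ-capacity certificates, kit-verified but not formalised, give `|Z| ≤ 13`).

**Proof.** WLOG (conjugating by `SL₂(𝔽₃)`, `IsSep.conj`, and translating `Z`) `1 ∈ Z` and the
code of `a = y₂y₁⁻¹` is a class representative.  The vectors `w_z` (`z ∈ Z`) are independent
(dual vectors `E_{z₀}`), every `w_{yᵢyⱼ⁻¹ z}` (`i ≠ j`, `z ∈ Z`) is killed by all `E_{z₀}`, and all of
them lie in the hyperplane `Σ = 0`.  The certificate of files VII/VII-b (`row3_alternatives`) then
gives: (dead) `w_u ∥ w_1`, contradicting `⟨w_1, E_1⟩ = 4`; or (tri) three independent garbage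
vectors, so `|Z| + 3 + 1 ≤ 20`; or (pool) either some `w_{uz}` leaves the pool support (again three
garbage vectors) or every `w_z` vanishes at a free coordinate `i₀`, so `|Z| + 2 + 2 ≤ 20`
(`capacity`, file VIII-a).
-/

set_option linter.dupNamespace false

namespace Summit.MatrixMultiplication.MatrixMultiplication.Theorems.GradedDesignFamily.Negative.SubfieldNine

open Matrix Module

/-! ### The six quotients of a triple -/

/-- The six quotients of a triple, as group elements (`k ≥ 5 ↦ ba⁻¹`). -/
def sixG (a b : GL (Fin 2) K) : ℕ → GL (Fin 2) K
  | 0 => a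
  | 1 => a⁻¹
  | 2 => b
  | 3 => b⁻¹
  | 4 => a * b⁻¹
  | _ => b * a⁻¹

/-- Matrices of the six quotients are the `sixM` of file VII-b. -/
theorem coe_sixG (a b : GL (Fin 2) K) : ∀ k : ℕ,
    ((sixG a b k : GL (Fin 2) K) : Mat) = sixM (a : Mat) (b : Mat) k
  | 0 => rfl
  | 1 => by show ((a⁻¹ : GL (Fin 2) K) : Mat) = inv2 (a : Mat); rw [inv2_coe]
  | 2 => rfl
  | 3 => by show ((b⁻¹ : GL (Fin 2) K) : Mat) = inv2 (b : Mat); rw [inv2_coe]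
  | 4 => by
    show ((a * b⁻¹ : GL (Fin 2) K) : Mat) = mul2 (a : Mat) (inv2 (b : Mat))
    rw [inv2_coe, mul2_eq, Units.val_mul]
  | _ + 5 => by
    show ((b * a⁻¹ : GL (Fin 2) K) : Mat) = mul2 (b : Mat) (inv2 (a : Mat))
    rw [inv2_coe, mul2_eq, Units.val_mul]

/-! ### The main lemma -/

/-- **Main lemma.** With `1 ∈ Z`, three distinct elements of `Y` and `y₂y₁⁻¹` a class
representative: `|Z| ≤ 16`. -/
theorem card_le_of_one_mem3 {Y Z : Finset (GL (Fin 2) K)} (hsep : IsSep Y Z)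
    {y₁ y₂ y₃ : GL (Fin 2) K} (hy₁ : y₁ ∈ Y) (hy₂ : y₂ ∈ Y) (hy₃ : y₃ ∈ Y) (h12 : y₁ ≠ y₂)
    (h13 : y₁ ≠ y₃) (h23 : y₂ ≠ y₃) (hrep : mc ((y₂ * y₁⁻¹ : GL (Fin 2) K) : Mat) ∈ repsC)
    (h1 : (1 : GL (Fin 2) K) ∈ Z) : Z.card ≤ 16 := by
  classical
  choose cf hcf using hsep
  let Zs := {z // z ∈ Z}
  -- pairing facts
  have PQ : ∀ (z₀ : Zs), ∀ y ∈ Y, ∀ y' ∈ Y, y ≠ y' → ∀ z ∈ Z,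
      pairL (Edual (cf z₀ z₀.2)) (w ((y * y'⁻¹ * z : GL (Fin 2) K) : Mat)) = 0 := by
    intro z₀ y hy y' hy' hne z hz
    rw [pairL_w, Theta]
    have : ∀ h : SL3, ∑ x : Vec, cf z₀ z₀.2 x ((phiM h * ((y * y'⁻¹ * z : GL (Fin 2) K) : Mat)) *ᵥ
        x) = 0 := by
      intro h
      have e := hcf z₀ z₀.2 h y hy y' hy' z hz
      rw [coe_conj, ← Units.val_mul] at e
      rw [e, if_neg]
      rintro ⟨-, h', -⟩; exact hne h'
    simp only [this, mul_zero, Finset.sum_const_zero]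
  have P3 : ∀ z₀ z : Zs, pairL (Edual (cf z₀ z₀.2)) (w ((z : GL (Fin 2) K) : Mat)) =
      if z = z₀ then 4 else 0 := by
    intro z₀ z
    rw [pairL_w, Theta]
    have : ∀ h : SL3, ∑ x : Vec, cf z₀ z₀.2 x ((phiM h * ((z : GL (Fin 2) K) : Mat)) *ᵥ x) =
        if h = 1 then (if (z : GL (Fin 2) K) = z₀ then 1 else 0) else 0 := by
      intro h
      have e := hcf z₀ z₀.2 h y₁ hy₁ y₁ hy₁ z z.2
      rw [mul_inv_cancel_right, Units.val_mul, ← phiM_eq] at e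
      rw [e]; simp only [true_and, ite_and]
    simp only [this, mul_ite, mul_one, mul_zero, Finset.sum_ite_eq', Finset.mem_univ,
      kexp_one, cval, if_pos, σ_two, Subtype.coe_inj]
    split_ifs <;> norm_num
  set a : GL (Fin 2) K := y₂ * y₁⁻¹ with ha
  set b : GL (Fin 2) K := y₃ * y₁⁻¹ with hb
  have hquot : ∀ k, ∃ y ∈ Y, ∃ y' ∈ Y, y ≠ y' ∧ sixG a b k = y * y'⁻¹ := by
    intro k
    match k with
    | 0 => exact ⟨y₂, hy₂, y₁, hy₁, h12.symm, rfl⟩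
    | 1 => exact ⟨y₁, hy₁, y₂, hy₂, h12, by show a⁻¹ = _; rw [ha, _root_.mul_inv_rev, inv_inv]⟩
    | 2 => exact ⟨y₃, hy₃, y₁, hy₁, h13.symm, rfl⟩
    | 3 => exact ⟨y₁, hy₁, y₃, hy₃, h13, by show b⁻¹ = _; rw [hb, _root_.mul_inv_rev, inv_inv]⟩
    | 4 => exact ⟨y₂, hy₂, y₃, hy₃, h23, by show a * b⁻¹ = _; rw [ha, hb]; group⟩
    | _ + 5 => exact ⟨y₃, hy₃, y₂, hy₂, h23.symm, by show b * a⁻¹ = _; rw [ha, hb]; group⟩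
  have PW : ∀ k (z₀ : Zs), ∀ z ∈ Z,
      pairL (Edual (cf z₀ z₀.2)) (w ((sixG a b k * z : GL (Fin 2) K) : Mat)) = 0 := by
    intro k z₀ z hz
    obtain ⟨y, hy, y', hy', hne, hk⟩ := hquot k
    rw [hk]; exact PQ z₀ y hy y' hy' hne z hz
  have PW1 : ∀ k (z₀ : Zs), pairL (Edual (cf z₀ z₀.2)) (w ((sixG a b k : GL (Fin 2) K) : Mat)) = 0 := by
    intro k z₀; have := PW k z₀ 1 h1; rwa [mul_one] at this
  -- the one-functional capacity count with three garbage vectors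
  have cap3 : ∀ p q r : Idx → ℂ, LinearIndependent ℂ ![p, q, r] →
      (∀ z₀ : Zs, pairL (Edual (cf z₀ z₀.2)) p = 0 ∧ pairL (Edual (cf z₀ z₀.2)) q = 0 ∧
        pairL (Edual (cf z₀ z₀.2)) r = 0) →
      pairL (fun _ => 1) p = 0 → pairL (fun _ => 1) q = 0 → pairL (fun _ => 1) r = 0 →
      Z.card ≤ 16 := by
    intro p q r hind hE0 hp hq hr
    have := capacity (Z := Z) (fun z₀ : Zs => Edual (cf z₀ z₀.2)) P3 _ hind
      (fun z₀ j => by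
        fin_cases j
        · exact (hE0 z₀).1
        · exact (hE0 z₀).2.1
        · exact (hE0 z₀).2.2)
      ![fun _ => 1] (fun l z => by fin_cases l; exact pairL_one_w _)
      (fun l j => by
        fin_cases l
        fin_cases j
        · exact hp
        · exact hq
        · exact hr)
      ![Pi.single ((0 : Fin 10), (0 : Fin 2)) 1]
      (by
        rw [Fintype.linearIndependent_iff]
        intro c hc l
        fin_cases l
        have h0 := congrFun hc 0
        simp only [Fin.sum_univ_one, Pi.smul_apply, Pi.zero_apply, smul_eq_mul] at h0
        have e1 : pairL (![fun _ => (1 : ℂ)] 0) (![Pi.single ((0 : Fin 10), (0 : Fin 2)) (1 : ℂ)] 0)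
            = 1 := pairL_one_single _
        rw [e1, mul_one] at h0
        exact h0)
    omega
  -- the alternatives of the certificate
  have halt := row3_alternatives (a : Mat) (b : Mat) (det2_coe_ne_zero a) (det2_coe_ne_zero b) hrep
  simp only [← coe_sixG] at halt
  rcases halt with ⟨k, hk⟩ | ⟨ku, kv, kx, hne, i, hx, hu, hv⟩ | ⟨⟨ku, kv, hne⟩, P, i₀, hP, hi₀, hall⟩
  · -- dead
    exfalso
    obtain ⟨c, hc0, hc⟩ := w_smul_of_kprop hk
    have h0 := PW1 k ⟨1, h1⟩
    rw [hc, map_smul, smul_eq_mul] at h0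
    have h4 := P3 ⟨1, h1⟩ ⟨1, h1⟩
    rw [if_pos rfl] at h4
    rw [show (((⟨1, h1⟩ : Zs) : GL (Fin 2) K) : Mat) = (1 : Mat) from Units.val_one] at h4
    rw [h4] at h0
    exact hc0 (by simpa using h0)
  · -- tri
    exact cap3 _ _ _ (linIndep_triple (fun c hc => hne (kprop_of_smul hc)) (w_ne_zero _)
      (w_ne_zero_of_vc hx) (w_eq_zero_of_vc hu) (w_eq_zero_of_vc hv))
      (fun z₀ => ⟨PW1 ku z₀, PW1 kv z₀, PW1 kx z₀⟩) (pairL_one_w _) (pairL_one_w _) (pairL_one_w _)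
  · -- pool
    by_cases hesc : ∃ z ∈ Z, ∃ k i, vc ((sixG a b k * z : GL (Fin 2) K) : Mat) i ≠ none ∧ ¬ P i
    · obtain ⟨z, hz, k, i, hi, hPi⟩ := hesc
      have hu : vc ((sixG a b ku : GL (Fin 2) K) : Mat) i = none := by
        by_contra h; exact hPi (hP ku i h)
      have hv : vc ((sixG a b kv : GL (Fin 2) K) : Mat) i = none := by
        by_contra h; exact hPi (hP kv i h)
      exact cap3 _ _ _ (linIndep_triple (fun c hc => hne (kprop_of_smul hc)) (w_ne_zero _)
        (w_ne_zero_of_vc hi) (w_eq_zero_of_vc hu) (w_eq_zero_of_vc hv))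
        (fun z₀ => ⟨PW1 ku z₀, PW1 kv z₀, PW k z₀ z hz⟩) (pairL_one_w _) (pairL_one_w _)
        (pairL_one_w _)
    · push Not at hesc
      have hzi : ∀ z : Zs, vc ((z : GL (Fin 2) K) : Mat) i₀ = none := by
        intro z
        rcases hall ((z : GL (Fin 2) K) : Mat) (det2_coe_ne_zero _) with ⟨k, i, hi, hPi⟩ | h
        · rw [mul2_eq, ← Units.val_mul] at hi
          exact absurd (hesc z z.2 k i hi) hPi
        · exact h
      have hu0 : vc ((sixG a b ku : GL (Fin 2) K) : Mat) i₀ = none := by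
        by_contra h; exact hi₀ (hP ku i₀ h)
      have hv0 : vc ((sixG a b kv : GL (Fin 2) K) : Mat) i₀ = none := by
        by_contra h; exact hi₀ (hP kv i₀ h)
      obtain ⟨i₁, hi₁⟩ : ∃ i₁ : Idx, i₁ ≠ i₀ := by
        by_cases h0 : i₀ = ((0 : Fin 10), (0 : Fin 2))
        · exact ⟨((0 : Fin 10), (1 : Fin 2)), by rw [h0]; decide⟩
        · exact ⟨((0 : Fin 10), (0 : Fin 2)), fun h => h0 h.symm⟩
      have hind := linIndep_pair (p := w ((sixG a b ku : GL (Fin 2) K) : Mat))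
        (q := w ((sixG a b kv : GL (Fin 2) K) : Mat)) (fun c hc => hne (kprop_of_smul hc))
        (w_ne_zero _)
      have := capacity (Z := Z) (fun z₀ : Zs => Edual (cf z₀ z₀.2)) P3 _ hind
        (fun z₀ j => by
          fin_cases j
          · exact PW1 ku z₀
          · exact PW1 kv z₀)
        ![fun _ => 1, Pi.single i₀ 1]
        (fun l z => by
          fin_cases l
          · exact pairL_one_w _
          · exact (pairL_single i₀ _).trans (w_eq_zero_of_vc (hzi z)))
        (fun l j => by
          fin_cases l
          · fin_cases j
            · exact pairL_one_w _
            · exact pairL_one_w _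
          · fin_cases j
            · exact (pairL_single i₀ _).trans (w_eq_zero_of_vc hu0)
            · exact (pairL_single i₀ _).trans (w_eq_zero_of_vc hv0))
        ![Pi.single i₀ 1, Pi.single i₁ 1]
        (by
          rw [Fintype.linearIndependent_iff]
          intro c hc
          have f00 : pairL (![fun _ => (1 : ℂ), Pi.single i₀ 1] 0) (![Pi.single i₀ (1 : ℂ),
              Pi.single i₁ 1] 0) = 1 := pairL_one_single _
          have f01 : pairL (![fun _ => (1 : ℂ), Pi.single i₀ 1] 1) (![Pi.single i₀ (1 : ℂ),
              Pi.single i₁ 1] 0) = 1 := by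
            show pairL (Pi.single i₀ 1) (Pi.single i₀ 1) = 1
            rw [pairL_single, Pi.single_eq_same]
          have f10 : pairL (![fun _ => (1 : ℂ), Pi.single i₀ 1] 0) (![Pi.single i₀ (1 : ℂ),
              Pi.single i₁ 1] 1) = 1 := pairL_one_single _
          have f11 : pairL (![fun _ => (1 : ℂ), Pi.single i₀ 1] 1) (![Pi.single i₀ (1 : ℂ),
              Pi.single i₁ 1] 1) = 0 := by
            show pairL (Pi.single i₀ 1) (Pi.single i₁ 1) = 0
            rw [pairL_single, Pi.single_eq_of_ne hi₁.symm]
          have h0 := congrFun hc 0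
          have h1' := congrFun hc 1
          simp only [Fin.sum_univ_two, Pi.add_apply, Pi.smul_apply, Pi.zero_apply, smul_eq_mul,
            f00, f01, f10, f11, mul_one, mul_zero, add_zero] at h0 h1'
          intro l
          fin_cases l
          · exact h1'
          · rw [h1', zero_add] at h0; exact h0)
      omega

/-- **Row `|Y| ≥ 3` of the `q = 3` subfield cell in the standard model:** a level-one separated
pair `(Y, Z)` with `|Y| ≥ 3` has `|Z| ≤ 16`. -/
theorem isSep_card_le_three (Y Z : Finset (GL (Fin 2) K)) (hsep : IsSep Y Z) (hY : 3 ≤ Y.card) :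
    Z.card ≤ 16 := by
  classical
  obtain ⟨y₁, hy₁, y₂, hy₂, y₃, hy₃, h12, h13, h23⟩ := Finset.two_lt_card.mp hY
  rcases Z.eq_empty_or_nonempty with rfl | ⟨z₁, hz₁⟩
  · simp
  have hne1 : ((y₂ * y₁⁻¹ : GL (Fin 2) K) : Mat) ≠ 1 := by
    intro h
    apply h12
    have : y₂ * y₁⁻¹ = 1 := Units.ext (by rw [h, Units.val_one])
    exact (mul_inv_eq_one.mp this).symm
  obtain ⟨g, hg⟩ := fact_reps _ (det2_coe_ne_zero _) hne1
  have hsep' := (hsep.conj g).translate (SpecialLinearGroup.mapGL K g * z₁)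
  set G : GL (Fin 2) K := SpecialLinearGroup.mapGL K g with hG
  have h1 : (1 : GL (Fin 2) K) ∈ (Z.image fun z => G * z).image (· * (G * z₁)⁻¹) :=
    Finset.mem_image.mpr ⟨G * z₁, Finset.mem_image.mpr ⟨z₁, hz₁, rfl⟩, mul_inv_cancel _⟩
  have hyi : ∀ y ∈ Y, G * y * G⁻¹ ∈ Y.image fun y => G * y * G⁻¹ :=
    fun y hy => Finset.mem_image.mpr ⟨y, hy, rfl⟩
  have hinj : Function.Injective fun y : GL (Fin 2) K => G * y * G⁻¹ := by
    intro y y' h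
    have h' : G * y * G⁻¹ = G * y' * G⁻¹ := h
    rwa [mul_left_inj, mul_right_inj] at h'
  have hrep : mc (((G * y₂ * G⁻¹) * (G * y₁ * G⁻¹)⁻¹ : GL (Fin 2) K) : Mat) ∈ repsC := by
    have e : (G * y₂ * G⁻¹) * (G * y₁ * G⁻¹)⁻¹ = G * (y₂ * y₁⁻¹) * G⁻¹ := by group
    have eGi : G⁻¹ = SpecialLinearGroup.mapGL K g⁻¹ := by rw [hG, map_inv]
    rw [e, Units.val_mul, Units.val_mul, eGi, hG, ← phiM_eq, ← phiM_eq, ← mul2_eq, ← mul2_eq]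
    exact hg
  have := card_le_of_one_mem3 hsep' (hyi y₁ hy₁) (hyi y₂ hy₂) (hyi y₃ hy₃) (hinj.ne h12)
    (hinj.ne h13) (hinj.ne h23) hrep h1
  rwa [Finset.card_image_of_injective _ (mul_left_injective _),
    Finset.card_image_of_injective _ (mul_right_injective G)] at this

/-- The `(3,17)` instance of the standard-model `q = 3` subfield cell is FALSE. -/
theorem subfieldCell_nine_std_no_3x17 :
    ¬ ∃ Y Z : Finset (GL (Fin 2) K), 3 ≤ Y.card ∧ 17 ≤ Z.card ∧ IsSep Y Z := by
  rintro ⟨Y, Z, hY, hZ, hsep⟩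
  have := isSep_card_le_three Y Z hsep hY
  omega

/-- **Row `|Y| ≥ 3` of the `q = 3` cell, in full generality:** for all `(k, K, φ)` with `|k| = 3`,
`|K| = |k|²`, `φ : SL₂(k) ↪ GL₂(K)`, every level-one separated pair `(Y, Z)` (S3's clause verbatim)
with `|Y| ≥ 3` has `|Z| ≤ 16`.  Finite-cell verdict, not summit progress. -/
theorem subfieldCell_nine_rowThree {k K' : Type} [Field k] [Fintype k] [DecidableEq k] [Field K']
    [Fintype K'] [DecidableEq K'] (hk : Fintype.card k = 3)
    (φ : Matrix.SpecialLinearGroup (Fin 2) k →* Matrix.GeneralLinearGroup (Fin 2) K')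
    (hφ : Function.Injective φ) (hK : Fintype.card K' = Fintype.card k ^ 2)
    (Y Z : Finset (Matrix.GeneralLinearGroup (Fin 2) K'))
    (hsep : ∀ z₀ ∈ Z, ∃ cf : (Fin 2 → K') → (Fin 2 → K') → ℂ,
      ∀ a : Matrix.SpecialLinearGroup (Fin 2) k, ∀ y ∈ Y, ∀ y' ∈ Y, ∀ z ∈ Z,
        (∑ u : Fin 2 → K', cf u (((φ a * y * y'⁻¹ * z : Matrix.GeneralLinearGroup (Fin 2) K') :
            Matrix (Fin 2) (Fin 2) K').mulVec u)) =
          if a = 1 ∧ y = y' ∧ z = z₀ then 1 else 0)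
    (hY : 3 ≤ Y.card) : Z.card ≤ 16 := by
  obtain ⟨Y', Z', hY', hZ', hsep'⟩ := isSep_transport hk φ hφ hK Y Z hsep
  have := isSep_card_le_three Y' Z' hsep' (by omega)
  omega

/-- The `(3,17)` instance of the `q = 3` subfield cell is FALSE for every `(k, K, φ)`. -/
theorem subfieldCell_nine_no_3x17 {k K' : Type} [Field k] [Fintype k] [DecidableEq k] [Field K']
    [Fintype K'] [DecidableEq K'] (hk : Fintype.card k = 3)
    (φ : Matrix.SpecialLinearGroup (Fin 2) k →* Matrix.GeneralLinearGroup (Fin 2) K')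
    (hφ : Function.Injective φ) (hK : Fintype.card K' = Fintype.card k ^ 2) :
    ¬ ∃ Y Z : Finset (Matrix.GeneralLinearGroup (Fin 2) K'), 3 ≤ Y.card ∧ 17 ≤ Z.card ∧
      ∀ z₀ ∈ Z, ∃ cf : (Fin 2 → K') → (Fin 2 → K') → ℂ,
        ∀ a : Matrix.SpecialLinearGroup (Fin 2) k, ∀ y ∈ Y, ∀ y' ∈ Y, ∀ z ∈ Z,
          (∑ u : Fin 2 → K', cf u (((φ a * y * y'⁻¹ * z : Matrix.GeneralLinearGroup (Fin 2) K') :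
              Matrix (Fin 2) (Fin 2) K').mulVec u)) =
            if a = 1 ∧ y = y' ∧ z = z₀ then 1 else 0 := by
  rintro ⟨Y, Z, hY, hZ, hsep⟩
  have := subfieldCell_nine_rowThree hk φ hφ hK Y Z hsep hY
  omega

end Summit.MatrixMultiplication.MatrixMultiplication.Theorems.GradedDesignFamily.Negative.SubfieldNine
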